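import Summits.CriticalPhenomena.SAWScalingLimit.Theses.SAWAsymptoticMorera
import Summits.CriticalPhenomena.SAWScalingLimit.Theorems.SAWAsymptoticMoreraSubseqIdentificationParaSplit
import HarnessLib

/-!
# The split glue item `SAWAsymptoticMorera.SubseqIdentificationOfParaSubs` holds (stmt-CriticalPhenomena-20255)

`SubseqIdentificationOfParaSubs := SlitParaObservableUniform → ParaMartingalesOfSlitUniform → LimitsDescribable →
EndpointRobust → SubseqIdentification` (route `SAWAsymptoticMorera`, rev 7, split gen 1 of stmt-CriticalPhenomena-0783)
is, definitionally, the landed theorem `SubseqIdentification_morera_of_slitUniform_of_passage` (p174122). No `sorry`.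
-/

namespace Summit.CriticalPhenomena.SAWScalingLimit.Theorems

/-- The glue of the para split of `SubseqIdentification` on route `SAWAsymptoticMorera` holds. [folklore] -/
theorem sawAsymptoticMorera_subseqIdentificationOfParaSubs_proof :
    Summit.CriticalPhenomena.SAWScalingLimit.Theses.SAWAsymptoticMorera.SubseqIdentificationOfParaSubs :=
  fun h₁ h₂ h₃ h₄ =>
    Summit.CriticalPhenomena.SAWScalingLimit.Theorems.SubseqIdentification.ParaMartingale.SubseqIdentification_morera_of_slitUniform_of_passage
      h₁ h₂ h₃ h₄

end Summit.CriticalPhenomena.SAWScalingLimit.Theorems
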